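import Summits.ResolutionOfSingularities.ResolutionOfSingularities.Theorems.FrobeniusClosingSteerBetaGlueDownstairs
import HarnessLib

/-!
# Crux `Steer` (stmt-ResolutionOfSingularities-16345), chain W4.1, β-LEAF, K-β2♭ part (III), file X3: DOWNSTAIRS bookkeeping for the
# glue `xLetterLawHat_of` at the `x`-chart origin — the transform of a cleaning is a cleaning, `φ(𝔪) ⊆ (φ x)` (def-free)

OURS (campaign `res-hironaka`, rung L ★L-G4, slot W4.1; statements about the route's own objects; they replace the
role of no printed item and are NOT statements of the manuscript under review [claim: Hironaka2017, status:
under-review]; AI review is weaker than expert review). Seat res-D-pv-003 (gen 7), K-β2♭ owner; GLUE (III) per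
res-L0-w41-plan-1 RULING 276(a).

* `strictTransform_cleaning_eq_X` — along `φ y = φ x · v₁` the strict transform of `f + x^a y^b q²` is `f₁ + (φ x)^a₁ v₁^b q₁²`
  (`2k + a₁ = a + b + d`, `a₁ ≤ 1`).
* `exists_map_eq_mul_of_mem_maximalIdeal_X` — `φ(𝔪) ⊆ (φ x)`.

[cite: CossartJannsenSaito2020, Lemma 12.1] No Theses file is imported; nothing here is a route item or a registration.
-/

noncomputable section

-- `Summit.<S>.<S>.…` duplicates the summit name by design (single-problem summit).
set_option linter.dupNamespace false

namespace Summit.ResolutionOfSingularities.ResolutionOfSingularities.Theorems.SwitchingDichotomy.BetaNewton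

open IsLocalRing
open Literature.AlgebraicGeometry.Resolution
open Summit.ResolutionOfSingularities.ResolutionOfSingularities.Theorems.SwitchingDichotomy.BetaPolygon
open Summit.ResolutionOfSingularities.ResolutionOfSingularities.Theorems.SwitchingDichotomy.BetaLetter (range_four)

variable {S S₁ : Type} [CommRing S] [CommRing S₁]

/-- **Along the `x`-chart letter at the origin the strict transform of the cleaning `f + x^a y^b q²` is the cleaning
`f₁ + (φ x)^a₁ v₁^b q₁²`** (`f₁ · (φ x)^d = φ f`, `g · (φ x)^d = φ (f + x^a y^b q²)`, `2k + a₁ = a + b + d`, `a₁ ≤ 1`, `a + b ≤ d`).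
[cite: CossartJannsenSaito2020, Lemma 12.1] -/
theorem strictTransform_cleaning_eq_X [IsLocalRing S₁] (φ : S →+* S₁) {x y : S} {v₁ z₁ w₁ : S₁}
    (ht' : IsRsopPart ![φ x, v₁, z₁, w₁]) (hy : φ y = φ x * v₁) {d k a b a₁ : ℕ} (hk : 2 * k + a₁ = a + b + d)
    (ha₁ : a₁ ≤ 1) (hab : a + b ≤ d) {f q : S} {f₁ g : S₁} (hf : f₁ * φ x ^ d = φ f)
    (hg : g * φ x ^ d = φ (f + x ^ a * y ^ b * q ^ 2)) :
    ∃ q₁ : S₁, g = f₁ + φ x ^ a₁ * v₁ ^ b * q₁ ^ 2 := by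
  haveI := ht'.isRegularLocalRing
  haveI : IsDomain S₁ := isDomain_of_isRegularLocalRing S₁
  have hpx : Prime (φ x) := by simpa using ht'.prime 0
  have hxv : ¬ φ x ∣ v₁ := by simpa using ht'.not_dvd (i := 0) (j := 1) (by decide)
  have hx0 : φ x ≠ 0 := hpx.ne_zero
  have hmain : (g - f₁) * φ x ^ d = v₁ ^ b * φ x ^ (a + b) * φ q ^ 2 := by
    rw [sub_mul, hg, hf, map_add, map_mul, map_mul, map_pow, map_pow, map_pow, hy]; ring
  set m : ℕ := d - (a + b) with hm
  have hdiv : φ x ^ m ∣ φ q ^ 2 := by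
    have h1 : φ x ^ m ∣ v₁ ^ b * φ q ^ 2 := by
      have : φ x ^ (a + b) * (φ x ^ m * (g - f₁)) = φ x ^ (a + b) * (v₁ ^ b * φ q ^ 2) := by
        calc φ x ^ (a + b) * (φ x ^ m * (g - f₁)) = (g - f₁) * φ x ^ d := by
              rw [hm, ← mul_assoc, ← pow_add, Nat.add_sub_cancel' hab]; ring
          _ = _ := by rw [hmain]; ring
      have := mul_left_cancel₀ (pow_ne_zero _ hx0) this
      exact ⟨g - f₁, by rw [← this]⟩
    exact hpx.pow_dvd_of_dvd_mul_left m (fun h => hxv (hpx.dvd_of_dvd_pow h)) h1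
  obtain ⟨r, hr⟩ := pow_dvd_of_pow_dvd_sq hpx m hdiv
  have hpar : a + b + 2 * ((m + 1) / 2) - d = a₁ := by omega
  refine ⟨r, ?_⟩
  have : (g - f₁) * φ x ^ d = (φ x ^ a₁ * v₁ ^ b * r ^ 2) * φ x ^ d := by
    rw [hmain, hr, ← hpar]
    have hle : d ≤ a + b + 2 * ((m + 1) / 2) := by omega
    obtain ⟨e, he⟩ := Nat.exists_eq_add_of_le hle
    rw [he, Nat.add_sub_cancel_left]
    have : a + b + 2 * ((m + 1) / 2) = d + e := he
    calc v₁ ^ b * φ x ^ (a + b) * (φ x ^ ((m + 1) / 2) * r) ^ 2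
        = v₁ ^ b * r ^ 2 * φ x ^ (a + b + 2 * ((m + 1) / 2)) := by ring
      _ = v₁ ^ b * r ^ 2 * φ x ^ (d + e) := by rw [this]
      _ = φ x ^ e * v₁ ^ b * r ^ 2 * φ x ^ d := by ring
  have := mul_right_cancel₀ (pow_ne_zero d hx0) this
  rw [← this]; ring

/-- **`φ(𝔪) ⊆ (φ x)` along the `x`-chart letter**: for `c ∈ 𝔪 = (x, y, z, w)` there is `e` with `φ c = φ x · e`. [folklore] -/
theorem exists_map_eq_mul_of_mem_maximalIdeal_X [IsLocalRing S] (φ : S →+* S₁) {x y z w : S} {v₁ z₁ w₁ : S₁}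
    (hspan : Ideal.span {x, y, z, w} = maximalIdeal S) (hy : φ y = φ x * v₁) (hz : φ z = φ x * z₁)
    (hw : φ w = φ x * w₁) {c : S} (hc : c ∈ maximalIdeal S) : ∃ e : S₁, φ c = φ x * e := by
  rw [← hspan, ← range_four] at hc
  obtain ⟨γ, rfl⟩ := Ideal.mem_span_range_iff_exists_fun.mp hc
  refine ⟨φ (γ 0) + φ (γ 1) * v₁ + φ (γ 2) * z₁ + φ (γ 3) * w₁, ?_⟩
  rw [map_sum, Fin.sum_univ_four]
  simp only [map_mul, Matrix.cons_val_zero, Matrix.cons_val_one, Matrix.cons_val, hy, hz, hw]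
  ring

end Summit.ResolutionOfSingularities.ResolutionOfSingularities.Theorems.SwitchingDichotomy.BetaNewton

end
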